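import Literature.Probability.Percolation.HorizontalTransportGM
import HarnessLib

/-!
# Transport of horizontal crossings: the statement for `P_{α,ξ} → P_{α,β}` (Prop. 6.4)

Grimmett–Manolescu, *Bond percolation on isoradial graphs* (PTRF 159 (2014) 273–327 =
arXiv:1204.0505), §6.2–§6.3. The transports `HData.horizontal_transport_gm` (Prop. 6.4) and
`VData.vertical_transport_gm` (Prop. 6.8) were proved for the *strip* lattices: the source
measure has the regular angle `ξ` on the rows `0 … N-1` (and other rows elsewhere), the target
has `β_0, …, β_{K-1}` on the rows `0 … K-1`. Since their events only look at edges between the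
heights where the rows agree with the homogeneous lattices `G_{α,ξ}` resp. `G_{α,β}`
("`B(N, N)` lies entirely in the regular block of `G^0`", "`B(4N, δN)` lies in the irregular
section of `G^N`", §6.3; similarly §6.2), the same inequalities hold for the honest measures
`P_{α,ξ} = prodBernoulli (gmWeight α (fun _ => ξ))` and `P_{α,β} = prodBernoulli (gmWeight α β)`.
This file proves that passage:

* `measurableSet_setOf_isLatticeWalk` and the measurability of the four events;
* `determinedBy_…` — each event is determined by the edges between its heights
  (`PercolationEvents.DeterminedBy`), and `gmWeight_eq_of_rows` — `gmWeight α rows e` depends on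
  `rows` only through the row of `e`; whence `prodBernoulli_real_eq_of_determinedBy`
  (`ProdBernoulliClusterLocality`) exchanges the measures;
* **`horizontal_transport`** (Prop. 6.4) and **`vertical_transport`** (Prop. 6.8) for
  `P_{α,ξ} → P_{α,β}`, uniformly over all `α, β, ξ` with `ξ - α_i, β_j - α_i ∈ [ε, π - ε]`.

## References

* G. R. Grimmett, I. Manolescu, PTRF 159 (2014) 273–327, arXiv:1204.0505, §6.2 (Prop. 6.4),
  §6.3 (Prop. 6.8).
-/

noncomputable section

namespace Literature.Probability.Percolation

open LatticeModels StarTriangle Real MeasureTheory Complex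

namespace TrackExchange

/-! ### The transports for the honest measures -/

/-- **Proposition 6.4 for `P_{α,ξ} → P_{α,β}`.** For `0 < ε ≤ π/2` there are `λ, N₀ ≥ 1` such that
for all `ρ ≥ 1`, `N ≥ N₀` and all `α, β, ξ` with `ξ - α_i, β_j - α_i ∈ [ε, π - ε]`:
`(1 - ρe^{-N}) · P_{α,ξ}(E_N) ≤ P_{α,β}(finalEventGM ρ N (λN))`.
[cite: GrimmettManolescu2014Isoradial, §6.2 Proposition 6.4] -/
theorem horizontal_transport {ε : ℝ} (hε : 0 < ε) (hε' : ε ≤ π / 2) :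
    ∃ lam N₀ : ℕ, 1 ≤ lam ∧ 1 ≤ N₀ ∧ ∀ (ρ N : ℕ), 1 ≤ ρ → N₀ ≤ N → ∀ (α β : ℤ → ℝ) (ξ : ℝ),
      AnglesIn ε α (fun _ => ξ) → AnglesIn ε α β →
      (1 - ρ * Real.exp (-N)) * (prodBernoulli (Percolation.gmWeight α fun _ => ξ)).real (initEventGM ρ N) ≤
        (prodBernoulli (Percolation.gmWeight α β)).real (finalEventGM ρ N (lam * N)) := by
  obtain ⟨lam, N₀, hlam, h⟩ := HData.horizontal_transport_gm hε hε'
  refine ⟨lam, max N₀ 1, hlam, le_max_right _ _, fun ρ N hρ hN α β ξ hξ hβ => ?_⟩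
  have hN₀ : N₀ ≤ N := le_trans (le_max_left _ _) hN
  have hN1 : 1 ≤ N := le_trans (le_max_right _ _) hN
  -- the data of the strip
  let H : HData := ⟨(ρ + 1) * N + 2 * (lam * N) + 3, α, fun k => β k, ξ, N, lam * N⟩
  have hH : H.Valid ε :=
    { ε_pos := hε, ε_le := hε', M_pos := by show 0 < (ρ + 1) * N + 2 * (lam * N) + 3; omega
      N_pos := hN1, ξα := fun i _ _ => hξ i 0, βα := fun k i _ _ => hβ i k }
  have key := h ρ N hρ hN₀ H hH rfl (by show (((ρ + 1) * N : ℕ) : ℤ) + 2 * (lam * N : ℕ) + 3 ≤ (((ρ + 1) * N + 2 * (lam * N) + 3 : ℕ) : ℤ); push_cast; rfl)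
  -- exchange the measures on the two events
  have e1 : (prodBernoulli (Percolation.gmWeight H.α (H.rowAngle 0))).real (initEventGM ρ N) =
      (prodBernoulli (Percolation.gmWeight α fun _ => ξ)).real (initEventGM ρ N) :=
    prodBernoulli_real_eq_of_determinedBy _ _ (gmWeight_eq_of_rows α (fun j hj hjN => by
      show H.rowAngle 0 j = ξ
      unfold HData.rowAngle
      have h1 : ¬ j < ((0 : ℕ) : ℤ) := by push_cast; omega
      have h2 : j < (H.N : ℤ) + ((0 : ℕ) : ℤ) := by show j < (N : ℤ) + ((0 : ℕ) : ℤ); push_cast; omega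
      rw [if_neg h1, if_pos h2])) (determinedBy_initEventGM ρ N) (measurableSet_initEventGM ρ N)
  have e2 : (prodBernoulli (Percolation.gmWeight H.α (H.rowAngle H.K))).real (finalEventGM ρ N H.K) =
      (prodBernoulli (Percolation.gmWeight α β)).real (finalEventGM ρ N (lam * N)) :=
    prodBernoulli_real_eq_of_determinedBy _ _ (gmWeight_eq_of_rows α (fun j hj hjK => by
      show H.rowAngle H.K j = β j
      unfold HData.rowAngle
      have h1 : j < ((lam * N : ℕ) : ℤ) := hjK
      rw [if_pos h1]
      show β (j.toNat : ℤ) = β j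
      rw [Int.toNat_of_nonneg hj])) (determinedBy_finalEventGM ρ N _) (measurableSet_finalEventGM ρ N _)
  -- to real numbers
  by_cases hc : 1 - ρ * Real.exp (-N) ≤ 0
  · exact le_trans (mul_nonpos_of_nonpos_of_nonneg hc measureReal_nonneg) measureReal_nonneg
  push Not at hc
  have hfin : prodBernoulli (Percolation.gmWeight H.α (H.rowAngle H.K)) (finalEventGM ρ N H.K) ≠ ⊤ := measure_ne_top _ _
  have := ENNReal.toReal_mono hfin key
  rw [ENNReal.toReal_mul, ENNReal.toReal_ofReal hc.le] at this
  rw [← e1, ← e2]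
  exact this

end TrackExchange

end Literature.Probability.Percolation
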